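import Summits.RiemannHypothesis.RiemannHypothesis.Theorems.PfPersistenceM2UpperLeak
import HarnessLib

/-!
# M2 upper half — addendum: the leak exponent cannot be lowered below the edge exponent (typed negative knowledge)

pub-rhpf cell (M2 seat, generation 3).  HONEST FRAMING: long-odds MECHANISM SEARCH; no RH claims.  PROVED here
(kernel-checked, RH-free): if the in-window leak of the Connes guess admits an eventual LOWER bound of size
`D N^q e^{−2πN} √u` at some point of the window (`ProlateLeakLower D q Λ`, an explicitly named `@[conjecture] def`,
taken as an argument), then no `sup` leak bound `ProlateLeakSup A p Λ'` (part 7) with `p < q` can hold: `q ≤ p`.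
On paper (HOME/M2-ROUTE.md §9.4 OPTIMALITY + HOME/pub-rhpf-m2/E2-THEOREM.md §3; DERIVED, unrefereed) THEOREM E″'s own
blocks give the lower bound with the SAME edge size as the upper bound, `(1 − o(1)) κ₀ λ^{1/2} √λ₄ ε₄ ≍ N³ e^{−2πN}`
(Fuchs 1964 two-sided endpoint asymptotics), i.e. `ProlateLeakLower D 3 Λ`; so the exponent `p = 3` of the M2 seat's
input `ProlateLeakSup A 3 Λ` is OPTIMAL for the prolate-guess witness family, and any further gain in the upper-law
exponent `B_U = 2p + 1 + δ` must come from the chain leak → energy, not from the prolate side.  Nothing here bounds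
the Weil ground energy from below; nothing implies or assumes RH.
-/

noncomputable section

set_option linter.dupNamespace false  -- the mandated namespace repeats `RiemannHypothesis`

open Set Filter Topology
open Literature.NumberTheory.LFunctions

namespace Summit.RiemannHypothesis.RiemannHypothesis.Theorems.PfPersistenceM2Leak

section ExponentFloor

/-- **HYPOTHESIS (EDGE LOWER BOUND), RH-free, prolate-only** (obligation node; DERIVED on paper with `q = 3`
from THEOREM E″'s tail blocks + Fuchs's endpoint asymptotics — E2-THEOREM.md §3 OPTIMALITY): for integer `N ≥ Λ`
the leak of the Connes guess is at least `D N^q e^{−2πN} √u` at SOME point `u` of the window `(0, 1/√N)`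
(on paper: as `u → (1/√N)⁻`, where the Riemann sum sees the window-edge value). -/
@[conjecture] def ProlateLeakLower (D q Λ : ℝ) : Prop :=
  ∀ N : ℕ, Λ ≤ (N : ℝ) → ∀ f0 f4 : ℝ → ℝ,
    IsProlateFunction (Real.sqrt N) 0 f0 → IsProlateFunction (Real.sqrt N) 4 f4 →
    ∃ u : ℝ, 0 < u ∧ u < 1 / Real.sqrt N ∧
      D * (N : ℝ) ^ q * Real.exp (-(2 * Real.pi * N)) * Real.sqrt u
        ≤ |connesE (prolateGuessH (Real.sqrt N) f0 f4) u|

/-- **PROVED: the exponent floor.**  An eventual edge lower bound with exponent `q` and a `sup` leak bound with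
exponent `p` force `q ≤ p` (prolate functions exist for every `N ≥ 1` by Slepian–Pollak, the named fact
`existsUnique_isProlateFunction`). -/
theorem le_of_prolateLeakLower_of_prolateLeakSup (hE : existsUnique_isProlateFunction) {D q Λ₁ A p Λ₂ : ℝ}
    (hD : 0 < D) (hL : ProlateLeakLower D q Λ₁) (hS : ProlateLeakSup A p Λ₂) : q ≤ p := by
  by_contra hqp
  push Not at hqp
  have hqp' : 0 < q - p := sub_pos.mpr hqp
  -- for every admissible `N`, `D N^q ≤ A N^p`
  have key : ∀ N : ℕ, 1 ≤ N → Λ₁ ≤ (N : ℝ) → Λ₂ ≤ (N : ℝ) → D * (N : ℝ) ^ (q - p) ≤ A := by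
    intro N hN1 hN₁ hN₂
    have hNpos : (0 : ℝ) < N := by exact_mod_cast hN1
    have hsq : 0 < Real.sqrt N := Real.sqrt_pos.mpr hNpos
    obtain ⟨f0, h0, -⟩ := hE (Real.sqrt N) hsq 0 ⟨0, by norm_num⟩
    obtain ⟨f4, h4, -⟩ := hE (Real.sqrt N) hsq 4 ⟨2, by norm_num⟩
    obtain ⟨u, hu, hul, hlow⟩ := hL N hN₁ f0 f4 h0 h4
    have hup := hS N hN₂ f0 f4 h0 h4 u hu hul
    have hchain : D * (N : ℝ) ^ q * Real.exp (-(2 * Real.pi * N)) * Real.sqrt u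
        ≤ A * (N : ℝ) ^ p * Real.exp (-(2 * Real.pi * N)) * Real.sqrt u := hlow.trans hup
    have hw : 0 < Real.exp (-(2 * Real.pi * N)) * Real.sqrt u :=
      mul_pos (Real.exp_pos _) (Real.sqrt_pos.mpr hu)
    have h1 : D * (N : ℝ) ^ q ≤ A * (N : ℝ) ^ p := by
      have : D * (N : ℝ) ^ q * (Real.exp (-(2 * Real.pi * N)) * Real.sqrt u)
          ≤ A * (N : ℝ) ^ p * (Real.exp (-(2 * Real.pi * N)) * Real.sqrt u) := by
        simpa only [mul_assoc] using hchain
      exact le_of_mul_le_mul_right this hw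
    have hNp : 0 < (N : ℝ) ^ p := Real.rpow_pos_of_pos hNpos p
    have hsplit : (N : ℝ) ^ q = (N : ℝ) ^ (q - p) * (N : ℝ) ^ p := by
      rw [← Real.rpow_add hNpos]; congr 1; ring
    rw [hsplit, ← mul_assoc] at h1
    exact le_of_mul_le_mul_right h1 hNp
  -- but `N^(q-p) → ∞`
  have hT : Tendsto (fun N : ℕ ↦ D * (N : ℝ) ^ (q - p)) atTop atTop :=
    Tendsto.const_mul_atTop hD ((tendsto_rpow_atTop hqp').comp tendsto_natCast_atTop_atTop)
  have hev : ∀ᶠ N : ℕ in atTop, A + 1 ≤ D * (N : ℝ) ^ (q - p) := hT.eventually_ge_atTop (A + 1)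
  have hev1 : ∀ᶠ N : ℕ in atTop, 1 ≤ N := eventually_ge_atTop 1
  have hevΛ₁ : ∀ᶠ N : ℕ in atTop, Λ₁ ≤ (N : ℝ) :=
    (tendsto_natCast_atTop_atTop (R := ℝ)).eventually_ge_atTop Λ₁
  have hevΛ₂ : ∀ᶠ N : ℕ in atTop, Λ₂ ≤ (N : ℝ) :=
    (tendsto_natCast_atTop_atTop (R := ℝ)).eventually_ge_atTop Λ₂
  obtain ⟨N, hNA, hN1, hN₁, hN₂⟩ := (hev.and (hev1.and (hevΛ₁.and hevΛ₂))).exists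
  have := key N hN1 hN₁ hN₂
  linarith

/-- Contrapositive packaging: with an edge lower bound of exponent `q`, every `sup` leak bound has exponent `≥ q`;
in particular (on paper `q = 3`) the M2 seat's input `ProlateLeakSup A 3 Λ` cannot be improved on the prolate side. -/
theorem not_prolateLeakSup_of_lt (hE : existsUnique_isProlateFunction) {D q Λ₁ : ℝ} (hD : 0 < D)
    (hL : ProlateLeakLower D q Λ₁) {A p Λ₂ : ℝ} (hp : p < q) : ¬ ProlateLeakSup A p Λ₂ :=
  fun hS ↦ (lt_irrefl q) (lt_of_le_of_lt (le_of_prolateLeakLower_of_prolateLeakSup hE hD hL hS) hp)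

end ExponentFloor

end Summit.RiemannHypothesis.RiemannHypothesis.Theorems.PfPersistenceM2Leak

end
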